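import Literature.NumberTheory.EllipticCurves.CMNewformGamma0PrimitiveIsNewformProofs
import Literature.NumberTheory.EllipticCurves.HeckeGrossencharakterFunctionalEquationConductorProofs
import HarnessLib

/-!
# Hecke's functional equation for a Größencharakter of type `(m, 0)` of an imaginary quadratic field (existential-constant form) —
# the named fact `Hecke_functionalEquation_infinityType` HOLDS

Topic `Literature/NumberTheory/EllipticCurves`; namespace `Literature.NumberTheory.EllipticCurves`.  THEOREMS ONLY (no definition, no named fact,
no instance, no `sorry`).  `HeckeGrossencharakterFunctionalEquation.lean` recorded the named fact `Hecke_functionalEquation_infinityType` (de Shalit II §1.1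
(1)–(3) / Greenberg 1987 §1 / Neukirch VII (8.5)–(8.6), with the conductor constant `B` quantified EXISTENTIALLY);
`CMNewformGamma0PrimitiveIsNewformProofs.lean` derived it from the conductor-pinned fact (`Hecke_functionalEquation_infinityType_of_conductor`); and
`HeckeGrossencharakterFunctionalEquationConductorProofs.lean` PROVES the pinned fact (`Hecke_functionalEquation_infinityType_conductor_holds`, Hecke's theta
integral with the harmonic weight).  Composing:

* ★ `Hecke_functionalEquation_infinityType_holds : Hecke_functionalEquation_infinityType`.

References: [deShalit1987] II §1.1 (1)–(3); [Greenberg1987] §1; [NeukirchANT1999] Ch. VII §8 (8.5)–(8.6); [HeckeMathZ1920].  Filed for the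
`Rank1Residual` / K7r doors of `Summits/BirchSwinnertonDyer` that cite the existential form; nothing about BSD is proved here.
`lean search 'Hecke_functionalEquation_infinityType_holds'` (2026-09-01): none.
-/

noncomputable section

namespace Literature.NumberTheory.EllipticCurves

/-- ★ **Hecke's functional equation (type `(m,0)`, `m ≥ 1`, imaginary quadratic `K`; existential constant `B`) HOLDS**: the named fact
`Hecke_functionalEquation_infinityType` VERBATIM, from the proved conductor-pinned form (`B = √(d_K·N𝔣_χ)/(2π)`).
[cite: deShalit1987, II.1.1 (1)–(3)] [cite: Greenberg1987, §1 (pp. 223–224)] [cite: NeukirchANT1999, Ch. VII §8 Thm. (8.5), Cor. (8.6)] -/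
theorem Hecke_functionalEquation_infinityType_holds : Hecke_functionalEquation_infinityType :=
  Hecke_functionalEquation_infinityType_of_conductor Hecke_functionalEquation_infinityType_conductor_holds

end Literature.NumberTheory.EllipticCurves

end
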